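import Mathlib.Algebra.Order.BigOperators.Group.Finset
import Mathlib.Algebra.Order.AbsoluteValue.Basic
import Summits.QuantumAdvantage.QuantumAdvantage.Theorems.CubicForrelationNearExactIsExactInvariantWeight

/-!
# Crux `CubicForrelation.NearExactIsExact` (stmt-QuantumAdvantage-14043) — DICKSON'S BOUND from a symplectic frame, on any number of bits

Certificate seat `b2b-cforr-cert` (gen 40).  HONEST FRAMING: kernel-checked elementary counting (standard axioms) — the `n`-bit version of
`tdq_frame_card` (…TwelveDigitProfile, which is the case `n = 12`), tool T6 of the Lean roadmap for `E1280-even`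
(HOME/b2b-cforr-cert-g40/LEAN-PLAN-E1280-EVEN.md §3): the cell lemmas of the light-cell analysis (HOME/b2b-cforr-cert-g37/R2-PARTNER.md §3)
are weight bounds for 8- and 9-variable quadratics from the rank of their alternating part, i.e. from a symplectic frame
(…CubicFormSymplectic `tcs_frame_exists`).  Nothing about `θ₁₂`; NOT summit progress.

* `tcd_frame_card`: if a Boolean `q` on `n` bits admits `h` pairs `(bᵢ, cᵢ)` with `q(x) ⊕ q(x⊕bᵢ) ⊕ q(x⊕cᵢ) ⊕ q(x⊕bᵢ⊕cᵢ) = 1`,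
  `… ⊕ q(x⊕bᵢ⊕cⱼ) = 0 (i ≠ j)` and `q(x) ⊕ q(x⊕bᵢ) ⊕ q(x⊕bⱼ) ⊕ q(x⊕bᵢ⊕bⱼ) = 0`, then `|2ⁿ − 2·#{q = 1}| ≤ 2^{n−h}` (as the two
  inequalities `2ⁿ ≤ 2#{q=1} + 2^{n−h}` and `2#{q=1} ≤ 2ⁿ + 2^{n−h}`), and `h ≤ n`.

References: L. E. Dickson (1901); F. J. MacWilliams, N. J. A. Sloane (1977) Ch. 15 §2 Thm 4.  Axioms: the standard three.
-/

set_option linter.dupNamespace false -- D-0017: single-problem summit ⇒ `QuantumAdvantage.QuantumAdvantage` by design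

namespace Summit.QuantumAdvantage.QuantumAdvantage.Theorems.CubicForrelation.NearExactIsExact

open Finset
open Literature.Computability.QuantumComplexity.BuzetChailloux (bxor zeroVec bxor_zeroVec bxor_self)

variable {n : ℕ}

/-- **Dickson's bound from a symplectic frame (any number of bits).**  See the module docstring. [cite: MacWilliamsSloane1977, Ch. 15 §2] -/
theorem tcd_frame_card (q : (Fin n → Bool) → Bool) (h : ℕ) (b c : Fin h → (Fin n → Bool))
    (hbc : ∀ i x, ((q x ^^ q (bxor x (b i))) ^^ (q (bxor x (c i)) ^^ q (bxor (bxor x (c i)) (b i)))) = true)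
    (hbc' : ∀ i j x, i ≠ j → ((q x ^^ q (bxor x (b i))) ^^ (q (bxor x (c j)) ^^ q (bxor (bxor x (c j)) (b i)))) = false)
    (hbb : ∀ i j x, ((q x ^^ q (bxor x (b i))) ^^ (q (bxor x (b j)) ^^ q (bxor (bxor x (b j)) (b i)))) = false) :
    h ≤ n ∧ 2 ^ n ≤ 2 * #(univ.filter fun x : Fin n → Bool => q x = true) + 2 ^ (n - h) ∧
      2 * #(univ.filter fun x : Fin n → Bool => q x = true) ≤ 2 ^ n + 2 ^ (n - h) := by
  classical
  have hcancel : ∀ x a : Fin n → Bool, bxor (bxor x a) a = x := fun x a => by rw [iw_bxor_assoc, bxor_self, bxor_zeroVec]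
  set D : Fin h → (Fin n → Bool) → Bool := fun i x => q x ^^ q (bxor x (b i)) with hDdef
  -- invariances
  have hDb : ∀ i j x, D i (bxor x (b j)) = D i x := by
    intro i j x
    have e := hbb i j x
    rw [hDdef]; simp only
    revert e
    cases q x <;> cases q (bxor x (b i)) <;> cases q (bxor x (b j)) <;> cases q (bxor (bxor x (b j)) (b i)) <;> simp
  have hDc' : ∀ i j x, i ≠ j → D i (bxor x (c j)) = D i x := by
    intro i j x hij
    have e := hbc' i j x hij
    rw [hDdef]; simp only
    revert e
    cases q x <;> cases q (bxor x (b i)) <;> cases q (bxor x (c j)) <;> cases q (bxor (bxor x (c j)) (b i)) <;> simp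
  have hDc : ∀ i x, D i (bxor x (c i)) = !(D i x) := by
    intro i x
    have e := hbc i x
    rw [hDdef]; simp only
    revert e
    cases q x <;> cases q (bxor x (b i)) <;> cases q (bxor x (c i)) <;> cases q (bxor (bxor x (c i)) (b i)) <;> simp
  -- the nested sets `Z_k = {x : D_i q x = 0 for i < k}`
  set Z : ℕ → Finset (Fin n → Bool) := fun k => univ.filter fun x => ∀ i : Fin h, i.val < k → D i x = false with hZdef
  have key : ∀ k, k ≤ h →
      (∑ x, (if q x = true then (-1 : ℤ) else 1)) = ∑ x ∈ Z k, (if q x = true then (-1 : ℤ) else 1) ∧ #(Z k) * 2 ^ k = 2 ^ n := by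
    intro k
    induction k with
    | zero =>
      intro _
      have hZ0 : Z 0 = univ := by
        rw [hZdef]; ext x; simp
      rw [hZ0, pow_zero, mul_one, card_univ, Fintype.card_fun, Fintype.card_bool, Fintype.card_fin]
      exact ⟨rfl, rfl⟩
    | succ k ih =>
      intro hk
      obtain ⟨ihA, ihB⟩ := ih (Nat.le_of_succ_le hk)
      have hkh : k < h := hk
      set i₀ : Fin h := ⟨k, hkh⟩ with hi₀
      have hZsucc : Z (k + 1) = (Z k).filter fun x => D i₀ x = false := by
        rw [hZdef]; ext x
        simp only [mem_filter, mem_univ, true_and]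
        constructor
        · intro hx
          exact ⟨fun i hi => hx i (Nat.lt_succ_of_lt hi), hx i₀ (by rw [hi₀]; exact Nat.lt_succ_self k)⟩
        · rintro ⟨hx, h0⟩ i hi
          rcases Nat.lt_succ_iff_lt_or_eq.1 hi with hlt | heq
          · exact hx i hlt
          · have : i = i₀ := Fin.ext (by rw [hi₀]; exact heq)
            rw [this]; exact h0
      -- (A): the part of the sum over `Z k ∩ {D i₀ = 1}` vanishes (involution `x ↦ x ⊕ b i₀`)
      have hA : ∑ x ∈ (Z k).filter (fun x => D i₀ x = true), (if q x = true then (-1 : ℤ) else 1) = 0 := by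
        refine Finset.sum_involution (fun x _ => bxor x (b i₀)) (fun x hx => ?_) (fun x hx _ => ?_) (fun x hx => ?_)
          (fun x _ => hcancel x (b i₀))
        · have hD1 : D i₀ x = true := (mem_filter.1 hx).2
          rw [hDdef] at hD1; simp only at hD1
          revert hD1
          cases q x <;> cases q (bxor x (b i₀)) <;> simp
        · have hD1 : D i₀ x = true := (mem_filter.1 hx).2
          intro hfix
          rw [hDdef] at hD1; simp only at hD1
          rw [hfix] at hD1
          revert hD1; cases q x <;> simp
        · obtain ⟨hxZ, hD1⟩ := mem_filter.1 hx
          refine mem_filter.2 ⟨?_, by rw [hDb]; exact hD1⟩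
          rw [hZdef] at hxZ ⊢
          simp only [mem_filter, mem_univ, true_and] at hxZ ⊢
          intro i hi
          rw [hDb]; exact hxZ i hi
      have hsumZ : ∑ x ∈ Z k, (if q x = true then (-1 : ℤ) else 1) = ∑ x ∈ Z (k + 1), (if q x = true then (-1 : ℤ) else 1) := by
        rw [← sum_filter_add_sum_filter_not (Z k) (fun x => D i₀ x = true), hA, zero_add, hZsucc]
        refine sum_congr ?_ fun _ _ => rfl
        ext x; simp only [mem_filter, Bool.not_eq_true]
      -- (B): `x ↦ x ⊕ c i₀` swaps the two halves of `Z k`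
      have hB : #((Z k).filter fun x => D i₀ x = false) = #((Z k).filter fun x => D i₀ x = true) := by
        have himg : ((Z k).filter fun x => D i₀ x = true) = ((Z k).filter fun x => D i₀ x = false).image (fun x => bxor x (c i₀)) := by
          ext y
          simp only [mem_filter, mem_image]
          constructor
          · rintro ⟨hyZ, hD1⟩
            refine ⟨bxor y (c i₀), ⟨?_, ?_⟩, hcancel y (c i₀)⟩
            · rw [hZdef] at hyZ ⊢
              simp only [mem_filter, mem_univ, true_and] at hyZ ⊢
              intro i hi
              have hne : i ≠ i₀ := by
                intro heq; rw [heq, hi₀] at hi; exact lt_irrefl k hi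
              rw [hDc' i i₀ y hne]; exact hyZ i hi
            · rw [hDc, hD1]; rfl
          · rintro ⟨x, ⟨hxZ, hD0⟩, rfl⟩
            refine ⟨?_, by rw [hDc, hD0]; rfl⟩
            rw [hZdef] at hxZ ⊢
            simp only [mem_filter, mem_univ, true_and] at hxZ ⊢
            intro i hi
            have hne : i ≠ i₀ := by
              intro heq; rw [heq, hi₀] at hi; exact lt_irrefl k hi
            rw [hDc' i i₀ x hne]; exact hxZ i hi
        have hinj : Function.Injective (fun x : Fin n → Bool => bxor x (c i₀)) := by
          intro x y hxy
          have e := congrArg (fun z : Fin n → Bool => bxor z (c i₀)) hxy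
          simp only [hcancel] at e
          exact e
        rw [himg, card_image_of_injective _ hinj]
      have hcard : #(Z (k + 1)) * 2 ^ (k + 1) = 2 ^ n := by
        have hsplit := card_filter_add_card_filter_not (s := Z k) (fun x => D i₀ x = false)
        have hnot : ((Z k).filter fun x => ¬ D i₀ x = false) = ((Z k).filter fun x => D i₀ x = true) := by
          refine filter_congr fun x _ => ?_
          cases D i₀ x <;> simp
        rw [hnot, ← hB, ← hZsucc] at hsplit
        rw [pow_succ, ← ihB, ← hsplit]
        ring
      exact ⟨ihA.trans hsumZ, hcard⟩
  obtain ⟨hA, hB⟩ := key h le_rfl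
  -- `h ≤ n` since `#Z_h · 2^h = 2^n` with `#Z_h ≥ 1`? use `2^h ∣ 2^n` via the positive factor
  have hZpos : 0 < #(Z h) := by
    rcases Nat.eq_zero_or_pos #(Z h) with h0 | hpos
    · rw [h0, zero_mul] at hB; exact absurd hB (by positivity)
    · exact hpos
  have hhn : h ≤ n := by
    by_contra hlt
    rw [not_le] at hlt
    have : 2 ^ n < 2 ^ h := Nat.pow_lt_pow_right (by norm_num) hlt
    have : 2 ^ h ≤ #(Z h) * 2 ^ h := Nat.le_mul_of_pos_left _ hZpos
    omega
  -- `#Z_h = 2^{n−h}`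
  have hZcard : #(Z h) = 2 ^ (n - h) := by
    have hnh : 2 ^ (n - h) * 2 ^ h = 2 ^ n := by
      rw [← pow_add, Nat.sub_add_cancel hhn]
    exact Nat.eq_of_mul_eq_mul_right (by positivity) (hB.trans hnh.symm)
  have habs : |∑ x ∈ Z h, (if q x = true then (-1 : ℤ) else 1)| ≤ (#(Z h) : ℤ) := by
    refine (abs_sum_le_sum_abs _ _).trans ?_
    have : ∑ x ∈ Z h, |(if q x = true then (-1 : ℤ) else 1)| = ∑ x ∈ Z h, (1 : ℤ) :=
      sum_congr rfl fun x _ => by split_ifs <;> simp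
    rw [this, sum_const, nsmul_eq_mul, mul_one]
  -- the signed sum in terms of the count
  have hsgn : ∑ x, (if q x = true then (-1 : ℤ) else 1) = (2 : ℤ) ^ n - 2 * (#(univ.filter fun x : Fin n → Bool => q x = true) : ℤ) := by
    have e : ∀ x, (if q x = true then (-1 : ℤ) else 1) = 1 - 2 * (if q x = true then (1 : ℤ) else 0) := fun x => by
      split_ifs <;> norm_num
    rw [sum_congr rfl fun x _ => e x, sum_sub_distrib, sum_const, ← mul_sum, sum_boole, card_univ, Fintype.card_fun,
      Fintype.card_bool, Fintype.card_fin]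
    simp only [nsmul_eq_mul, mul_one]
    push_cast
    ring
  have hZ : ((#(Z h) : ℕ) : ℤ) = (2 : ℤ) ^ (n - h) := by rw [hZcard]; push_cast; rfl
  rw [hA] at hsgn
  rw [hsgn, hZ] at habs
  obtain ⟨h1, h2⟩ := abs_le.1 habs
  refine ⟨hhn, ?_, ?_⟩
  · zify
    linarith
  · zify
    linarith

end Summit.QuantumAdvantage.QuantumAdvantage.Theorems.CubicForrelation.NearExactIsExact
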